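import Summits.BirchSwinnertonDyer.BirchSwinnertonDyer.Theorems.PrintCf2SplitBadTwoFirstLayerInertAtSeven
import Literature.NumberTheory.EllipticCurves.IwasawaSelmerControlKernelProofs
import HarnessLib

/-!
# Crux `PrintCf2.SplitBadTwoRankOneOfFacts` (stmt-BirchSwinnertonDyer-20368), road α v10.3 — brick B15 §2, file 7:
# THE CONTROL KERNEL VANISHES AT EVERY LAYER `K_n` of the line (LEAD g12's input for B17 / (R-TOP′)), unconditionally on every frame

Cell `bsd-print-cf2`, width seat `bsd-line-cf2-p1-w6` g2 (prover-bsd-line-cf2-p1-w6-g2-0); `--supports stmt-BirchSwinnertonDyer-20368`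
(helper, Theses-free). HONEST FRAMING: nothing here closes the crux or a registered stub; BSD is not proved by any of this; no summit
statement is proved by this seat. No definition, no named fact, no `sorry`.

WHAT. LEAD g12's HINT for B17 (STATUS 20:32:43Z): Greenberg's Prop. 4.14/4.15 argument («`X` has no nonzero finite `Λ`-submodule») runs at
`p = 2` if the control kernels `ker(𝔖_{v̄}(K_n, W*) → 𝔖_{v̄}(K*_∞, W*))` vanish at EVERY level `n` — «H7 AT EVERY LAYER». This file proves it:
* §1 `eq_zero_of_resOfLe_eq_zero_of_resOfLe_decomp_eq_zero_of_le` — file 1's inflation argument INSIDE an open subgroup `H ≥ ker κ` of `Γ_K`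
  (any `K`, `p`, `κ`, discrete `M`, place `w` with `I_w ≤ ker κ`, `M^{I_w} ⊆ M^{Γ_K}`, and `δ ∈ D_w ∩ H` such that every open subgroup of
  `Γ_K` containing `ker κ` and `δ` contains `H`): a class of `H¹(H, M)` dying on `ker κ` and locally trivial at `w` is `0`;
  `restrictedSelmer_inf_ker_resOfLe_eq_bot_of_le` (the `𝔖`-form, `w ∤ p`).
* §2 **`restrictedSelmer_layer_inf_ker_resOfLe_eq_bot`** — `H = κ⁻¹(pⁿℤ_p) = Gal(K̄/K_n)`: under (H7) «`¬ D_w ≤ κ⁻¹(pℤ_p)`» some `δ₀ ∈ D_w` has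
  `κ δ₀ ∈ ℤ_pˣ` (file 1), so `δ₀^{pⁿ} ∈ D_w ∩ κ⁻¹(pⁿℤ_p)` generates `κ⁻¹(pⁿℤ_p)` over `ker κ` (tree `ZpExtension.layerSubgroup_le_of_isOpen` for the
  unit twist `u·κ`, same kernel and layers) — `w` is TOTALLY INERT in `K_∞`; hence **`𝔖_𝔮(K_n, M) ⊓ ker (res : H¹(K_n, M) → H¹(K_∞, M)) = ⊥`
  for EVERY `n`**, from the single level-one hypothesis (H7).
* §3 ROAD α, **`ker_control_layer_of_frame_eq_bot`**: on every S3c₂ frame (member `C • W = cm7^{(d)}`, `K` imaginary quadratic, `2 = v v̄`,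
  `π² = π − 2`, `r² = r − 2`, `κ′` ANY `ℤ₂`-line unramified outside `v̄`) and EVERY `n`:
  `𝔖_{v̄}(K_n, W*) ⊓ ker (res → H¹(K*_∞, W*)) = ⊥` — NO hypothesis ((H7) is file 4's `not_decomp_seven_le_layerSubgroup_one_of_frame`,
  `W*^{I_{w₇}} ⊆ W*^{Γ_K}` is file 1's `smul_eq_self_of_inertia_fixed_of_hasAdditiveReductionAt`).
presearch: Greenberg LNM 1716 §3 Lemma 3.1 (p. 86) and §4 Prop. 4.14–4.15, Agboola 2007 §3 Prop. 3.2 — held; no new fact. beyond-print theorem: no.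

References: [GreenbergLNM1716] §3 Lemma 3.1, §4 Prop. 4.14–4.15; [Agboola2007] §3 Prop. 3.2; [Washington1997] §13.1;
[SerreGaloisCohomology1997] I §2.6.
-/

noncomputable section

open scoped Classical

set_option linter.dupNamespace false
set_option autoImplicit false

open NumberField IsDedekindDomain Field WeierstrassCurve
open Literature.NumberTheory.EllipticCurves Literature.NumberTheory.EllipticCurves.GreenbergSelmer
open Literature.NumberTheory.EllipticCurves.Agboola2007
open Literature.NumberTheory.EllipticCurves.IwasawaDual
open Literature.NumberTheory.EllipticCurves.ResKernel
open Literature.NumberTheory.GaloisRepresentations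

universe u

namespace Summit.BirchSwinnertonDyer.BirchSwinnertonDyer.Theorems.PrintCf2.RestrictedSelmerPair

/-! ## §1. The inflation argument inside an open subgroup `H ≥ ker κ` -/

section Subgroup

variable {K : Type u} [Field K] [NumberField K] {p : ℕ} [Fact p.Prime] (κ : ZpExtension K p)
  (M : Type u) [AddCommGroup M] [DistribMulAction (absoluteGaloisGroup K) M]
  [TopologicalSpace M] [DiscreteTopology M] (w : HeightOneSpectrum (𝓞 K))

omit [NumberField K] in
/-- Transport of topological generation from `Γ_K` into an OPEN subgroup `H ≥ N`: if every open subgroup of `Γ_K` containing `N` and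
`δ ∈ H` contains `H`, then every open subgroup of `↥H` containing `N.subgroupOf H` and `⟨δ, _⟩` is all of `↥H`.
[cite: SerreGaloisCohomology1997, I §2.5] -/
theorem eq_top_of_isOpen_subgroupOf_of_isOpen {N H : Subgroup (absoluteGaloisGroup K)} (hNH : N ≤ H)
    (hH : IsOpen (H : Set (absoluteGaloisGroup K))) {δ : absoluteGaloisGroup K} (hδH : δ ∈ H)
    (hgen : ∀ U : Subgroup (absoluteGaloisGroup K), IsOpen (U : Set (absoluteGaloisGroup K)) → N ≤ U → δ ∈ U → H ≤ U)
    (U : Subgroup ↥H) (hU : IsOpen (U : Set ↥H)) (hNU : N.subgroupOf H ≤ U) (hδU : (⟨δ, hδH⟩ : ↥H) ∈ U) : U = ⊤ := by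
  set U' : Subgroup (absoluteGaloisGroup K) := U.map H.subtype with hU'def
  have hU' : IsOpen (U' : Set (absoluteGaloisGroup K)) := by
    rw [hU'def, Subgroup.coe_map, Subgroup.coe_subtype]
    exact hH.isOpenMap_subtype_val _ hU
  have hNU' : N ≤ U' := fun g hg ↦
    Subgroup.mem_map.mpr ⟨⟨g, hNH hg⟩, hNU (Subgroup.mem_subgroupOf.mpr hg), rfl⟩
  have hδU' : δ ∈ U' := Subgroup.mem_map.mpr ⟨⟨δ, hδH⟩, hδU, rfl⟩
  have hHU' : H ≤ U' := hgen U' hU' hNU' hδU'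
  rw [eq_top_iff]
  intro x _
  obtain ⟨y, hyU, hyx⟩ := Subgroup.mem_map.mp (hHU' x.2)
  have : y = x := Subtype.ext hyx
  exact this ▸ hyU

/-- **KERNEL-EXACT INSIDE AN OPEN SUBGROUP `H` (e.g. `Gal(K̄/K_n)`).** `K` a number field, `κ` a `ℤ_p`-extension, `M` a discrete
`Γ_K`-module with continuous orbit maps, `H` an open subgroup with `ker κ ≤ H`, `w` a finite place with `I_w ≤ ker κ` and
`M^{I_w} ⊆ M^{Γ_K}`, and `δ ∈ D_w ∩ H` such that `ker κ` and `δ` generate `H` topologically. Then a class of `H¹(H, M)` which dies on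
`ker κ` and is locally trivial at (the chosen place of `K̄^H` above) `w` is ZERO. File 1's `oneCocycleClass_eq_zero_of_principal_on` run in
`G = ↥H` with `N = ker κ`, `D = D_w ∩ H`, `I = I_w`. [cite: GreenbergLNM1716, §3 Lemma 3.1 (p. 86)] [cite: Agboola2007, §3 Prop. 3.2] -/
theorem eq_zero_of_resOfLe_eq_zero_of_resOfLe_decomp_eq_zero_of_le {H : Subgroup (absoluteGaloisGroup K)}
    (hNH : κ.kerSubgroup ≤ H) (hH : IsOpen (H : Set (absoluteGaloisGroup K)))
    (hcont : ∀ m : M, Continuous fun g : absoluteGaloisGroup K ↦ g • m)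
    (hI : GreenbergSelmer.inertia w ≤ κ.kerSubgroup)
    (hfix : ∀ m : M, (∀ i ∈ GreenbergSelmer.inertia w, i • m = m) → ∀ g : absoluteGaloisGroup K, g • m = m)
    {δ : absoluteGaloisGroup K} (hδD : δ ∈ decomp w) (hδH : δ ∈ H)
    (hgen : ∀ U : Subgroup (absoluteGaloisGroup K), IsOpen (U : Set (absoluteGaloisGroup K)) → κ.kerSubgroup ≤ U → δ ∈ U → H ≤ U)
    {c : subgroupH1 H M} (hker : resOfLe M hNH c = 0) (hloc : resOfLe M (inf_le_left : H ⊓ decomp w ≤ H) c = 0) : c = 0 := by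
  obtain ⟨z, rfl⟩ := oneCocycleClass_surjective _ c
  obtain ⟨a, ha⟩ := (CocycleCriteria.resOfLe_oneCocycleClass_eq_zero_iff _ z).mp hker
  obtain ⟨b, hb⟩ := (CocycleCriteria.resOfLe_oneCocycleClass_eq_zero_iff _ z).mp hloc
  refine oneCocycleClass_eq_zero_of_principal_on (G := ↥H)
    (fun m ↦ (hcont m).comp continuous_subtype_val)
    (κ.kerSubgroup.subgroupOf H) ((decomp w).subgroupOf H) ((GreenbergSelmer.inertia w).subgroupOf H)
    (fun x hx ↦ Subgroup.mem_subgroupOf.mpr (hI (Subgroup.mem_subgroupOf.mp hx)))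
    (fun x hx ↦ Subgroup.mem_subgroupOf.mpr (inertia_le_decomp w (Subgroup.mem_subgroupOf.mp hx)))
    (fun m hm g ↦ hfix m (fun i hi ↦ hm ⟨i, hNH (hI hi)⟩ (Subgroup.mem_subgroupOf.mpr hi)) g)
    (δ := ⟨δ, hδH⟩) (Subgroup.mem_subgroupOf.mpr hδD)
    (eq_top_of_isOpen_subgroupOf_of_isOpen hNH hH hδH hgen) z ?_ ?_
  · refine ⟨a, fun n hn ↦ ?_⟩
    have h := ha ⟨(n : absoluteGaloisGroup K), Subgroup.mem_subgroupOf.mp hn⟩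
    have e : Subgroup.inclusion hNH ⟨(n : absoluteGaloisGroup K), Subgroup.mem_subgroupOf.mp hn⟩ = n := Subtype.ext rfl
    rw [e] at h
    exact h
  · refine ⟨b, fun d hd ↦ ?_⟩
    have h := hb ⟨(d : absoluteGaloisGroup K), ⟨d.2, Subgroup.mem_subgroupOf.mp hd⟩⟩
    have e : Subgroup.inclusion (inf_le_left : H ⊓ decomp w ≤ H)
        ⟨(d : absoluteGaloisGroup K), ⟨d.2, Subgroup.mem_subgroupOf.mp hd⟩⟩ = d := Subtype.ext rfl
    rw [e] at h
    exact h

/-- **`𝔖_𝔮(K̄^H, M) ⊓ ker (res : H¹(H, M) → H¹(K_∞, M)) = ⊥`** under the hypotheses of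
`eq_zero_of_resOfLe_eq_zero_of_resOfLe_decomp_eq_zero_of_le`, for `H` normal and a place `w ∤ p` (the `𝔖`-condition at the chosen place
above `w` is `res_{H ⊓ D_w} = 0`, `mem_restrictedSelmer_iff_resOfLe` at `σ = 1`). [cite: Agboola2007, §3 Prop. 3.2 (arXiv p0008:L128–135)] -/
theorem restrictedSelmer_inf_ker_resOfLe_eq_bot_of_le {H : Subgroup (absoluteGaloisGroup K)} [H.Normal]
    (hNH : κ.kerSubgroup ≤ H) (hH : IsOpen (H : Set (absoluteGaloisGroup K))) (𝔮 : HeightOneSpectrum (𝓞 K))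
    (hcont : ∀ m : M, Continuous fun g : absoluteGaloisGroup K ↦ g • m) (hpw : ((p : ℕ) : 𝓞 K) ∉ w.asIdeal)
    (hI : GreenbergSelmer.inertia w ≤ κ.kerSubgroup)
    (hfix : ∀ m : M, (∀ i ∈ GreenbergSelmer.inertia w, i • m = m) → ∀ g : absoluteGaloisGroup K, g • m = m)
    {δ : absoluteGaloisGroup K} (hδD : δ ∈ decomp w) (hδH : δ ∈ H)
    (hgen : ∀ U : Subgroup (absoluteGaloisGroup K), IsOpen (U : Set (absoluteGaloisGroup K)) → κ.kerSubgroup ≤ U → δ ∈ U → H ≤ U) :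
    restrictedSelmer H M p 𝔮 ⊓ (resOfLe M hNH).ker = ⊥ := by
  rw [eq_bot_iff]
  rintro c ⟨hc, hcker⟩
  rw [AddSubgroup.mem_bot]
  have hloc : resOfLe M (inf_le_left : H ⊓ decomp w ≤ H) c = 0 := by
    have h := ((mem_restrictedSelmer_iff_resOfLe H M p 𝔮 c).mp hc).1 w hpw 1
    rwa [conjH1_one_holds H M, AddMonoidHom.id_apply] at h
  exact eq_zero_of_resOfLe_eq_zero_of_resOfLe_decomp_eq_zero_of_le κ M w hNH hH hcont hI hfix hδD hδH hgen hcker hloc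

end Subgroup

/-! ## §2. The layers `K_n`: `w` is totally inert under (H7), so the control kernel vanishes at every level -/

section Layer

variable {K : Type u} [Field K] [NumberField K] {p : ℕ} [Fact p.Prime] (κ : ZpExtension K p)
  (M : Type u) [AddCommGroup M] [DistribMulAction (absoluteGaloisGroup K) M]
  [TopologicalSpace M] [DiscreteTopology M] (w : HeightOneSpectrum (𝓞 K))

/-- **(H7) ⟹ `w` is TOTALLY INERT: a generator of every layer inside `D_w`.** If `¬ D_w ≤ κ⁻¹(pℤ_p)` then for every `n` some
`δ ∈ D_w ∩ κ⁻¹(pⁿℤ_p)` generates `κ⁻¹(pⁿℤ_p)` topologically together with `ker κ` (`δ = δ₀^{pⁿ}` with `κ δ₀ ∈ ℤ_pˣ`; the tree's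
`ZpExtension.layerSubgroup_le_of_isOpen` for the unit twist making `δ₀` a topological generator). [cite: Washington1997, §13.1] -/
theorem exists_mem_decomp_generator_layer (hsplit : ¬ decomp w ≤ κ.layerSubgroup 1) (n : ℕ) :
    ∃ δ ∈ decomp w, δ ∈ κ.layerSubgroup n ∧
      ∀ U : Subgroup (absoluteGaloisGroup K), IsOpen (U : Set (absoluteGaloisGroup K)) → κ.kerSubgroup ≤ U → δ ∈ U →
        κ.layerSubgroup n ≤ U := by
  obtain ⟨δ₀, hδ₀D, u, hδ₀⟩ := exists_mem_isTopGenerator_unitTwist_of_not_le_layerSubgroup_one κ hsplit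
  refine ⟨δ₀ ^ p ^ n, (decomp w).pow_mem hδ₀D _, ?_, fun U hU hN hδU ↦ ?_⟩
  · rw [← ZpExtension.layerSubgroup_unitTwist κ u n]
    exact (κ.unitTwist u).pow_mem_layerSubgroup hδ₀ n
  · rw [← ZpExtension.layerSubgroup_unitTwist κ u n]
    exact ZpExtension.layerSubgroup_le_of_isOpen (κ.unitTwist u) hδ₀ n U hU
      (by rw [ZpExtension.kerSubgroup_unitTwist]; exact hN) hδU

/-- **THE CONTROL KERNEL VANISHES AT EVERY LAYER.** `K` a number field, `κ` a `ℤ_p`-extension, `M` a discrete `Γ_K`-module with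
continuous orbit maps, `w ∤ p` a place with `I_w ≤ ker κ`, `M^{I_w} ⊆ M^{Γ_K}`, and (H7) `¬ D_w ≤ κ⁻¹(pℤ_p)`. Then for every `n` and every
distinguished `𝔮`: **`𝔖_𝔮(K_n, M) ⊓ ker (res : H¹(K_n, M) → H¹(K_∞, M)) = ⊥`** (`K_n = K̄^{κ⁻¹(pⁿℤ_p)}`). The level-`n` analogue of file 1's
`restrictedSelmerBase_inf_ker_resOfLe_eq_bot`; LEAD g12's «H7 at every layer». [cite: GreenbergLNM1716, §3 Lemma 3.1 and §4 Prop. 4.15 (proof)]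
[cite: Agboola2007, §3 Prop. 3.2] -/
theorem restrictedSelmer_layer_inf_ker_resOfLe_eq_bot (𝔮 : HeightOneSpectrum (𝓞 K)) (n : ℕ)
    (hcont : ∀ m : M, Continuous fun g : absoluteGaloisGroup K ↦ g • m) (hpw : ((p : ℕ) : 𝓞 K) ∉ w.asIdeal)
    (hI : GreenbergSelmer.inertia w ≤ κ.kerSubgroup)
    (hfix : ∀ m : M, (∀ i ∈ GreenbergSelmer.inertia w, i • m = m) → ∀ g : absoluteGaloisGroup K, g • m = m)
    (hsplit : ¬ decomp w ≤ κ.layerSubgroup 1) :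
    restrictedSelmer (κ.layerSubgroup n) M p 𝔮 ⊓ (resOfLe M (κ.kerSubgroup_le_layerSubgroup n)).ker = ⊥ := by
  obtain ⟨δ, hδD, hδH, hgen⟩ := exists_mem_decomp_generator_layer κ w hsplit n
  exact restrictedSelmer_inf_ker_resOfLe_eq_bot_of_le κ M w (κ.kerSubgroup_le_layerSubgroup n)
    (ZpExtension.isOpen_layerSubgroup κ n) 𝔮 hcont hpw hI hfix hδD hδH hgen

end Layer

/-! ## §3. Road α: the control kernel vanishes at every layer `K_n` of `K*_∞`, on every S3c₂ frame, unconditionally -/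

section Frame

open Summit.BirchSwinnertonDyer.BirchSwinnertonDyer.Theorems.PrintCf2.AdditiveAtSeven
open Summit.BirchSwinnertonDyer.BirchSwinnertonDyer.Theorems.PrintCf2.FirstLayer

variable {K : Type} [Field K] [NumberField K]

/-- **ROAD α: `ker(𝔖_{v̄}(K_n, W*) → 𝔖_{v̄}(K*_∞, W*)) = 0` FOR EVERY `n`, ON EVERY FRAME** (member `C • W = cm7^{(d)}`, `K` imaginary quadratic,
`2 = v v̄` with `v ≠ v̄`, `π ∈ End_K(E_K)` with `π² = π − 2`, `r² = r − 2`, `κ′` ANY `ℤ₂`-extension unramified outside `v̄` — the binders of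
`stub_restrictedEulerCharBottom_two`): the input «control kernels vanish at every level» of LEAD g12's B17 route (Greenberg 4.14/4.15 with
«`E(K_n)[p] = 0`» replaced by H7-total-inertness at `w₇`). [cite: GreenbergLNM1716, §3 Lemma 3.1 and §4 Prop. 4.15 (proof)]
[cite: Agboola2007, §3 Prop. 3.2 (arXiv p0008:L128–135)] -/
theorem ker_control_layer_of_frame_eq_bot {d : ℤ} (hd0 : d ≠ 0) (W : WeierstrassCurve ℚ) [W.IsElliptic]
    (C : VariableChange ℚ) (hC : C • W = cm7.quadraticTwist (d : ℚ)) (hK : IsImaginaryQuadratic K)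
    (v vbar : HeightOneSpectrum (𝓞 K)) (hv : ((2 : ℕ) : 𝓞 K) ∈ v.asIdeal) (hvbar : ((2 : ℕ) : 𝓞 K) ∈ vbar.asIdeal)
    (hne : vbar ≠ v) (π : (W.baseChange K).endRing) (hrel : (π : AddMonoid.End (W.baseChange K).geomPoints) * π = π - 2)
    {r : ℤ_[2]} (hr : r * r = r - 2) (κ' : ZpExtension K 2) (hκ' : κ'.IsUnramifiedOutside vbar) (n : ℕ) :
    restrictedSelmer (κ'.layerSubgroup n) ↥((W.baseChange K).endEigenPrimaryTorsion 2 π r) 2 vbar ⊓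
      (resOfLe ↥((W.baseChange K).endEigenPrimaryTorsion 2 π r) (κ'.kerSubgroup_le_layerSubgroup n)).ker = ⊥ := by
  haveI : (W.baseChange K).IsElliptic := by rw [baseChange]; infer_instance
  have hj : W.j = -3375 := j_eq_of_smul_eq_cm7Twist hd0 W C hC
  obtain ⟨θ, hθ⟩ := exists_sq_eq_neg_seven_of_cmEndo_mem_endRing W K hj π hrel
  obtain ⟨w, h7⟩ := AdditiveAtSeven.exists_heightOneSpectrum_natCast_mem (K := K) (q := 7) (by norm_num)
  have h2w : ((2 : ℕ) : 𝓞 K) ∉ w.asIdeal := natCast_two_notMem_of_seven_mem w h7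
  have hw : w ≠ vbar := fun h ↦ h2w (h ▸ hvbar)
  exact restrictedSelmer_layer_inf_ker_resOfLe_eq_bot κ' ↥((W.baseChange K).endEigenPrimaryTorsion 2 π r) w vbar n
    (continuous_smul_endEigenPrimaryTorsion (W.baseChange K) 2 π r) h2w (hκ' w hw)
    (smul_eq_self_of_inertia_fixed_of_hasAdditiveReductionAt W hj hθ π hrel hr h2w
      (hasAdditiveReductionAt_baseChange_of_j_eq_cm7_of_finrank_eq_two K w hK.1 W hj h7))
    (not_decomp_seven_le_layerSubgroup_one_of_frame hK hθ hd0 W hC hv hvbar hne κ' hκ' h7)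

end Frame

end Summit.BirchSwinnertonDyer.BirchSwinnertonDyer.Theorems.PrintCf2.RestrictedSelmerPair

end
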